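/-
Copyright (c) 2026. All rights reserved.
Released under Apache 2.0 license as described in the file LICENSE.
Authors: abc-iut cell, statement-typer seat abc-iut-L4-t9 (wave 2, block W2-B2).
-/
import Literature.AnabelianGeometry.AbsoluteAnabelian.AbsTopIII.BiAnabelianIncompatibility
import Literature.AnabelianGeometry.AbsoluteAnabelian.AbsTopIII.AutHolLogFrobeniusIncompatibility

/-!
# [AbsTopIII] Corollary 3.7 (iv), first incompatibility — REDUCTION to the Lemma-3.4 obstruction

S. Mochizuki, *Topics in absolute anabelian geometry III* [MochizukiAbsTopIII2015] (manuscript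
`paper:url-5493eb38cbb7`), Cor 3.7 (iv) p. 88: "The diagram of categories `𝒟†_{≤2}` does not admit a
structure of core on `𝒟†_{≤1}` which [...] is compatible with [...] the observable `𝔖†_log` of (iii)";
proof p. 88: "entirely similar to" the proof of Cor 3.6 (iv) p. 81 ("by writing out explicitly the
meaning of such an equality `ζ'₁ = ζ₂`, we conclude that we obtain a contradiction to Lemma 3.4").

Proof-only companion of `BiAnabelianIncompatibility.lean` (abc-iut-L4-t9): for EVERY setting
`𝔖 : BiAnabelianSetting X E N`, the typed statement `IncompatibleStmt` FOLLOWS from the component-level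
obstruction `LogKernelObstruction` (at some object `x₀` of `𝒳`, no isomorphism `a : x₀ ⥲ log x₀` has
`λ^×(a) ≫ ι_{log,x₀} = ι_{×,x₀}`) — which for the MLF setting is Lemma 3.4 p. 74 — by one application
of abc-iut-L4-t10's general theorem `false_of_core_compatible_of_obstruction_left`
(`AutHolLogFrobeniusIncompatibility.lean`: in any diagram of categories, a family containing an
isomorphism for `([id₁], [id₀]∘[log])`, the pair `([λ^×],[λ^{×pf}])` with components `ι_×` and the
type-(1) pair with components `ι_log` forces `λ^×(ζ₀) ≫ ι_log = ι_×`), instantiated on `𝒟†_{≤3}` with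
`pr_⋎` for `id_⋎` and `x₀ ↦ δ_𝒳(x₀)`. Nothing here bears on [IUTchIII] Cor. 3.12.
-/

set_option autoImplicit false

namespace Literature.AnabelianGeometry.AbsoluteAnabelian.AbsTopIII

open CategoryTheory Quiver DiagramOfCategories

universe u

namespace BiAnabelianSetting

variable {X E N : Type u} [Category.{u} X] [Category.{u} E] [Category.{u} N]
  (𝔖 : BiAnabelianSetting X E N)

/-- The component-level obstruction behind the first incompatibility of [AbsTopIII] Cor 3.7 (iv): at
some object `x₀` of `𝒳`, for every isomorphism `a : x₀ ⥲ log x₀` the composite `λ^×(a) ≫ ι_{log,x₀}` is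
NOT `ι_{×,x₀}` — for the MLF setting this is Lemma 3.4 p.74 ("`α^pf((𝒪^▷_k)^pf) ⊄ (𝒪^×_k)^pf`").
[cite: MochizukiAbsTopIII2015, Lemma 3.4 p.74] -/
def LogKernelObstruction : Prop :=
  ∃ x₀ : X, ∀ a : x₀ ⟶ 𝔖.log.obj x₀, IsIso a →
    𝔖.lamTimes.map a ≫ 𝔖.iotaLog.app x₀ ≠ 𝔖.iotaTimes.app x₀

/-- **Cor 3.7 (iv), first incompatibility, REDUCED to the Lemma-3.4 obstruction** (for every setting):
a family on `𝒟†_{≤3}` containing isomorphisms for the pairs `([pr_{⋎+1}], [pr_⋎]∘[log_𝒳])` and the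
pinned `𝔖†_log` homotopies forces `λ^×(ζ₀) ≫ ι_{log} = ι_×` at `δ_𝒳(x₀)` (abc-iut-L4-t10's general
`false_of_core_compatible_of_obstruction_left`), contradicting the obstruction.
[cite: MochizukiAbsTopIII2015, Cor 3.7 (iv) p.88] -/
theorem incompatibleStmt_of_obstruction (h : 𝔖.LogKernelObstruction) : 𝔖.IncompatibleStmt := by
  obtain ⟨x₀, hx₀⟩ := h
  rintro ⟨K, hcore, ⟨hT, hhT⟩, hlog⟩
  obtain ⟨h₀, hiso⟩ := hcore 0
  obtain ⟨h₁, hh₁⟩ := hlog 0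
  exact false_of_core_compatible_of_obstruction_left K
    (v1 := lvFirst.{u} (0 + 1)) (v0 := lvFirst.{u} 0) (sq := lvBox.{u}) (ob := lvObs.{u})
    (eLog 0) (ePr (0 + 1)) (ePr 0) eLamTimes eLamPf 𝔖.iotaTimes 𝔖.iotaLogAt
    h₀ hiso hT hhT h₁ hh₁ (𝔖.diag.obj x₀) (fun a ha => hx₀ a ha)

end BiAnabelianSetting

end Literature.AnabelianGeometry.AbsoluteAnabelian.AbsTopIII
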